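import Mathlib
import HarnessLib
import Summits.HubbardSuperconductivity.HubbardSuperconductivity.Theorems.KLProgrammeSmoothTransitionCauchyBound

/-!
# Route `KLProgramme` — engine support (cell gate-hubbard-kl, #22a (2e) «sharp χ₂ table», seat p2 g18):
# a realistic all-orders derivative table for Mathlib's `Real.smoothTransition` by Cauchy estimates,
# `|smoothTransition^{(n)}(x)| ≤ n!·(5·(199n/99)ⁿ·e^{−n} + 2·(15/2)ⁿ)` for ALL `n` and ALL `x`

Continues `…KLProgrammeSmoothTransitionCauchyBound` (pointwise Cauchy bounds from the complexification, whose poles all lie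
on the circle `|z − ½| = ½`).  The tree's previous all-orders table `|σ^{(n)}| ≤ 8·(n!)²·256ⁿ` (`ExpNegInvGlueGevrey`, real-variable Gevrey-2
bookkeeping) is `≈ 10²⁷` times the truth at `n = 12` (`sup|σ^{(12)}| ≈ 6.9·10¹⁹`); the present table is within a factor `≈ 9–80` of the truth
for `3 ≤ n ≤ 16` and asymptotically `≍ (n!)²·(2.01/e·…)ⁿ`-sharp up to a polynomial factor (Cauchy's inequality on the disc `|z − x| < 0.99·x`
with the majorant `1/(e^{Re(1/z − 1/(1−z))} − 1)`, optimised at `x ≈ 1/(1.99 n)`).  Assembly: (I) the scaling discs `r = ρx` on `(0, x₁]`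
(`ρ = 99/100`, `x₁ = 3/20`), with `yⁿe^{−y} ≤ nⁿe^{−n}`; (II)/(III) three fixed discs on `[3/20, ½]` (real-part route on `[0.15, 0.297]`,
imaginary-part route on `[0.297, 0.484]` and `[0.484, ½]`); the reflection `σ(1−x) = 1 − σ(x)`; vanishing of the derivatives off `[0,1]`;
continuity at `0, 1`.  Such realistic cut-off tables are what the smooth-cutoff bookkeeping of constructive fermionic renormalisation consumes
(Disertori–Rivasseau 2000 §II.2: Gevrey cutoffs; Benfatto–Giuliani–Mastropietro 2006 §2.2 (2.9)); cell gate-hubbard-kl, #22a (2e) tail.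

* `stC_pow_mul_exp_neg_le_pow` — `yⁿ·e^{−y} ≤ nⁿ·e^{−n}` (`y ≥ 0`);
* `abs_iteratedDeriv_smoothTransition_le_scaling` — regime (I), general `ρ, x₁`; `smoothTransition_scaling_const_le_five` — its constant at `(99/100, 3/20)` is `≤ 5`;
* `abs_iteratedDeriv_smoothTransition_le_piece_re` / `…_piece_im_one` / `…_piece_im_two` — the `n`-uniform piece bounds (II)/(III);
* `abs_iteratedDeriv_smoothTransition_one_sub` — the reflection (`σ(1−x) = 1 − σ(x)`, cf. `Literature.NumberTheory.LFunctions.SelfDualAFE.smoothTransition_one_sub`); `iteratedDeriv_smoothTransition_eq_zero_of_lt_zero/_of_one_lt`;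
* **`abs_iteratedDeriv_smoothTransition_le_cauchy`** — the closed-form table for all `n`, all `x`;
* `stC_exp_neg_nat_le` — `e^{−n} ≤ (10¹⁰/27182818283)ⁿ` (for numeral rows: `n = 3: 5391`, `4: 161100`, `8: 1.11·10¹²`, `12: 6.013·10²⁰`, `16: 1.544·10³¹`,
  tabulated with the kit-certified sharp table in `…KLProgrammeSalmhoferCutoffDerivTableRecord`).

Everything is proved; no named facts; pure real analysis, nothing about the model (the `χ₂` corollary `(4/3)ⁿ×` is `…KLProgrammeSalmhoferCutoffCauchyTable`).

## Sources

S. G. Krantz, H. R. Parks, *A Primer of Real Analytic Functions*, 2nd ed., Birkhäuser 2002, Prop. 2.2.10 [`KrantzParks2002`];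
M. Disertori, V. Rivasseau, Commun. Math. Phys. 215 (2000) 251–290, §II.2 (II.13)–(II.14) footnote [`DisertoriRivasseau2000`];
G. Benfatto, A. Giuliani, V. Mastropietro, Ann. Henri Poincaré 7 (2006) 809–898, §2.2 (2.9) [`BenfattoGiulianiMastropietro2006`].
-/

noncomputable section

namespace Summit.HubbardSuperconductivity.HubbardSuperconductivity.Theorems.KLRegimeSplit

set_option linter.dupNamespace false -- summit = problem name (single-conjunct summit), D-0017

open Set Filter
open scoped Topology Nat

/-! ## §1 `yⁿ e^{−y} ≤ nⁿ e^{−n}` -/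

/-- `yⁿ·e^{−y} ≤ nⁿ·e^{−n}` for `y ≥ 0` (from `y/n ≤ e^{y/n − 1}`). [folklore] -/
theorem stC_pow_mul_exp_neg_le_pow (n : ℕ) {y : ℝ} (hy : 0 ≤ y) : y ^ n * Real.exp (-y) ≤ (n : ℝ) ^ n * Real.exp (-n) := by
  rcases Nat.eq_zero_or_pos n with rfl | hn
  · simp only [pow_zero, one_mul, CharP.cast_eq_zero, neg_zero, Real.exp_zero]
    exact Real.exp_le_one_iff.2 (by linarith)
  · have hn' : (0 : ℝ) < n := by exact_mod_cast hn
    have h1 : y / n ≤ Real.exp (y / n - 1) := by linarith [Real.add_one_le_exp (y / n - 1)]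
    have h2 : (y / n) ^ n ≤ Real.exp (y / n - 1) ^ n := pow_le_pow_left₀ (div_nonneg hy hn'.le) h1 n
    rw [← Real.exp_nat_mul, show (n : ℝ) * (y / n - 1) = y - n by field_simp, div_pow,
      div_le_iff₀ (pow_pos hn' n)] at h2
    calc y ^ n * Real.exp (-y) ≤ Real.exp (y - n) * (n : ℝ) ^ n * Real.exp (-y) := by gcongr
      _ = (n : ℝ) ^ n * (Real.exp (y - n) * Real.exp (-y)) := by ring
      _ = (n : ℝ) ^ n * Real.exp (-n) := by rw [← Real.exp_add]; ring_nf

/-! ## §2 Regime (I): the scaling discs `r = ρx` on `(0, x₁]` -/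

/-- **Regime (I)**: for `0 < ρ < 1`, `0 < x ≤ x₁` and `s₁ := (1+ρ)x₁ < ½`, with `κ := (1−s₁)⁻¹`, `y₁ := s₁⁻¹`:
`|σ^{(n)}(x)| ≤ n!·((1+ρ)/ρ)ⁿ·nⁿ·e^{−n}·e^{κ}/(1 − e^{κ−y₁})`. [cite: KrantzParks2002, Prop. 2.2.10] -/
theorem abs_iteratedDeriv_smoothTransition_le_scaling {ρ x₁ x : ℝ} (hρ0 : 0 < ρ) (hρ1 : ρ < 1) (hx0 : 0 < x) (hx : x ≤ x₁)
    (hs : (1 + ρ) * x₁ < 1 / 2) (n : ℕ) :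
    |iteratedDeriv n Real.smoothTransition x| ≤
      n ! * ((1 + ρ) / ρ) ^ n * (n : ℝ) ^ n * Real.exp (-n) *
        (Real.exp (1 - (1 + ρ) * x₁)⁻¹ / (1 - Real.exp ((1 - (1 + ρ) * x₁)⁻¹ - ((1 + ρ) * x₁)⁻¹))) := by
  set s₁ := (1 + ρ) * x₁ with hs₁
  set κ := (1 - s₁)⁻¹ with hκ
  set y₁ := s₁⁻¹ with hy₁
  set r := ρ * x with hr_def
  have hr : 0 < r := mul_pos hρ0 hx0
  have hrx : r < x := by nlinarith
  have hxr : x + r = (1 + ρ) * x := by ring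
  have hxrpos : 0 < x + r := by linarith
  have hxs : x + r ≤ s₁ := by rw [hxr]; exact mul_le_mul_of_nonneg_left hx (by linarith)
  have hs0 : 0 < s₁ := lt_of_lt_of_le hxrpos hxs
  have hx1 : x + r < 1 := by linarith
  set y := (x + r)⁻¹ with hy_def
  have hy0 : 0 < y := inv_pos.2 hxrpos
  have hyy : y₁ ≤ y := inv_anti₀ hxrpos hxs
  have hy1 : 2 < y₁ := by
    rw [hy₁, lt_inv_comm₀ two_pos hs0]; linarith
  have hκ2 : κ < 2 := by
    rw [hκ, inv_lt_comm₀ (by linarith) two_pos]; linarith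
  have hκ0 : 0 < κ := inv_pos.2 (by linarith)
  have hτge : y - κ ≤ (x + r)⁻¹ - (1 - x - r)⁻¹ := by
    have : (1 - x - r)⁻¹ ≤ κ := inv_anti₀ (by linarith) (by linarith)
    linarith
  have hτ : 0 < (x + r)⁻¹ - (1 - x - r)⁻¹ := by linarith
  have main := abs_iteratedDeriv_smoothTransition_le_of_re hr hrx hx1 hτ n
  set q := 1 - Real.exp (κ - y₁) with hq_def
  have hq : 0 < q := by
    have : Real.exp (κ - y₁) < 1 := Real.exp_lt_one_iff.2 (by linarith)
    linarith
  have hlow : Real.exp (y - κ) * q ≤ Real.exp ((x + r)⁻¹ - (1 - x - r)⁻¹) - 1 := by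
    have h1 : Real.exp (y - κ) ≤ Real.exp ((x + r)⁻¹ - (1 - x - r)⁻¹) := Real.exp_le_exp.2 hτge
    have h2 : Real.exp (y - κ) * Real.exp (κ - y₁) = Real.exp (y - y₁) := by rw [← Real.exp_add]; ring_nf
    have h3 : 1 ≤ Real.exp (y - y₁) := Real.one_le_exp (by linarith)
    calc Real.exp (y - κ) * q = Real.exp (y - κ) - Real.exp (y - κ) * Real.exp (κ - y₁) := by rw [hq_def]; ring
      _ = Real.exp (y - κ) - Real.exp (y - y₁) := by rw [h2]
      _ ≤ Real.exp ((x + r)⁻¹ - (1 - x - r)⁻¹) - 1 := by linarith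
  have hpos : 0 < Real.exp (y - κ) * q := mul_pos (Real.exp_pos _) hq
  have hinv : (Real.exp ((x + r)⁻¹ - (1 - x - r)⁻¹) - 1)⁻¹ ≤ Real.exp κ * Real.exp (-y) / q := by
    have e : (Real.exp (y - κ))⁻¹ = Real.exp κ * Real.exp (-y) := by
      rw [← Real.exp_neg, ← Real.exp_add]; ring_nf
    calc (Real.exp ((x + r)⁻¹ - (1 - x - r)⁻¹) - 1)⁻¹ ≤ (Real.exp (y - κ) * q)⁻¹ := inv_anti₀ hpos hlow
      _ = Real.exp κ * Real.exp (-y) / q := by rw [mul_inv, e, div_eq_mul_inv]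
  have hrn : (r ^ n)⁻¹ = ((1 + ρ) / ρ) ^ n * y ^ n := by
    rw [← inv_pow, ← mul_pow]
    congr 1
    rw [hy_def, hxr, hr_def]
    field_simp
  have hyn : y ^ n * Real.exp (-y) ≤ (n : ℝ) ^ n * Real.exp (-n) := stC_pow_mul_exp_neg_le_pow n hy0.le
  have hKq : 0 ≤ Real.exp κ / q := div_nonneg (Real.exp_pos _).le hq.le
  calc |iteratedDeriv n Real.smoothTransition x|
      ≤ n ! * (Real.exp ((x + r)⁻¹ - (1 - x - r)⁻¹) - 1)⁻¹ / r ^ n := main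
    _ = n ! * ((Real.exp ((x + r)⁻¹ - (1 - x - r)⁻¹) - 1)⁻¹ * (r ^ n)⁻¹) := by rw [div_eq_mul_inv, mul_assoc]
    _ ≤ n ! * ((Real.exp κ * Real.exp (-y) / q) * (((1 + ρ) / ρ) ^ n * y ^ n)) := by
        rw [hrn]
        gcongr
    _ = n ! * ((1 + ρ) / ρ) ^ n * (y ^ n * Real.exp (-y)) * (Real.exp κ / q) := by ring
    _ ≤ n ! * ((1 + ρ) / ρ) ^ n * ((n : ℝ) ^ n * Real.exp (-n)) * (Real.exp κ / q) := by gcongr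
    _ = _ := by rw [hq_def]; ring

/-- The regime-(I) constant at `ρ = 99/100`, `x₁ = 3/20` (`s₁ = 597/2000`, `κ = 2000/1403`, `y₁ = 2000/597`): `e^{κ}/(1 − e^{κ−y₁}) ≤ 5`. -/
theorem smoothTransition_scaling_const_le_five :
    Real.exp (1 - (1 + 99 / 100 : ℝ) * (3 / 20))⁻¹ / (1 - Real.exp ((1 - (1 + 99 / 100 : ℝ) * (3 / 20))⁻¹ - ((1 + 99 / 100 : ℝ) * (3 / 20))⁻¹)) ≤ 5 := by
  have e1 : (1 - (1 + 99 / 100 : ℝ) * (3 / 20))⁻¹ = 1 + 597 / 1403 := by norm_num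
  have e2 : ((1 + 99 / 100 : ℝ) * (3 / 20))⁻¹ = 2000 / 597 := by norm_num
  rw [e1, e2]
  have e3 : (1 + 597 / 1403 : ℝ) - 2000 / 597 = -(1612000 / 837591) := by norm_num
  rw [e3]
  -- e^{1 + s} ≤ 2.7182818286 · (Taylor bound), s = 597/1403
  have hk : Real.exp (1 + 597 / 1403) ≤ 2.7182818286 * 1.5304016 := by
    rw [Real.exp_add]
    have h1 : Real.exp 1 ≤ 2.7182818286 := Real.exp_one_lt_d9.le
    have h2 : Real.exp (597 / 1403 : ℝ) ≤ 1.5304016 := by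
      have h := Real.exp_bound' (show (0 : ℝ) ≤ 597 / 1403 by norm_num) (show (597 / 1403 : ℝ) ≤ 1 by norm_num)
        (show 0 < 5 by norm_num)
      simp only [Finset.sum_range_succ, Finset.sum_range_zero, Nat.factorial] at h
      norm_num at h
      linarith
    exact mul_le_mul h1 h2 (Real.exp_pos _).le (by norm_num)
  -- e^{−3u} ≤ 1/(1 + u + u²/2)³, u = 1612000/2512773
  have hd : Real.exp (-(1612000 / 837591 : ℝ)) ≤ 0.1586315 := by
    have hu : (1 : ℝ) + 1612000 / 2512773 + (1612000 / 2512773) ^ 2 / 2 ≤ Real.exp (1612000 / 2512773) :=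
      Real.quadratic_le_exp_of_nonneg (by norm_num)
    have h3 : (1 + 1612000 / 2512773 + (1612000 / 2512773 : ℝ) ^ 2 / 2) ^ 3 ≤ Real.exp (1612000 / 837591) := by
      have e : Real.exp (1612000 / 837591 : ℝ) = Real.exp (1612000 / 2512773) ^ 3 := by
        rw [← Real.exp_nat_mul]; norm_num
      rw [e]; exact pow_le_pow_left₀ (by norm_num) hu 3
    rw [Real.exp_neg]
    calc (Real.exp (1612000 / 837591 : ℝ))⁻¹ ≤ ((1 + 1612000 / 2512773 + (1612000 / 2512773 : ℝ) ^ 2 / 2) ^ 3)⁻¹ :=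
          inv_anti₀ (by positivity) h3
      _ ≤ 0.1586315 := by norm_num
  have hden : (0 : ℝ) < 1 - 0.1586315 := by norm_num
  calc Real.exp (1 + 597 / 1403) / (1 - Real.exp (-(1612000 / 837591 : ℝ)))
      ≤ (2.7182818286 * 1.5304016) / (1 - 0.1586315) := by
        apply div_le_div₀ (by norm_num) hk hden (by linarith)
    _ ≤ 5 := by norm_num

/-! ## §3 Regimes (II)/(III): `n`-uniform bounds on fixed-disc pieces of `[3/20, ½]` -/

/-- **Piece, real-part route**: on `x ∈ [a,b]` with a fixed radius `r < a`, `b + r < ½`, and a rational `E ≤ e^{τ_b}`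
(`τ_b = 1/(b+r) − 1/(1−b−r)`, `E = 2.7182818283ᵏ·(1 + τ_b − k)`, `k ≤ τ_b`, `E > 1`):
`|σ^{(n)}(x)| ≤ n!·(E − 1)⁻¹/rⁿ` for every `n`. [cite: KrantzParks2002, Prop. 2.2.10] -/
theorem abs_iteratedDeriv_smoothTransition_le_piece_re {a b r x : ℝ} (k : ℕ) (hr : 0 < r) (hra : r < a) (hb : b + r < 1 / 2)
    (hk : (k : ℝ) ≤ (b + r)⁻¹ - (1 - b - r)⁻¹)
    (hE1 : 1 < (2.7182818283 : ℝ) ^ k * (1 + ((b + r)⁻¹ - (1 - b - r)⁻¹ - k)))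
    (hx : x ∈ Icc a b) (n : ℕ) :
    |iteratedDeriv n Real.smoothTransition x| ≤
      n ! * ((2.7182818283 : ℝ) ^ k * (1 + ((b + r)⁻¹ - (1 - b - r)⁻¹ - k)) - 1)⁻¹ / r ^ n := by
  set τb := (b + r)⁻¹ - (1 - b - r)⁻¹ with hτb
  set E := (2.7182818283 : ℝ) ^ k * (1 + (τb - k)) with hE
  have hxa := hx.1
  have hxb := hx.2
  have hrx : r < x := by linarith
  have hx1 : x + r < 1 := by linarith
  have hxr0 : 0 < x + r := by linarith
  have hτx : τb ≤ (x + r)⁻¹ - (1 - x - r)⁻¹ := by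
    have h1 : (b + r)⁻¹ ≤ (x + r)⁻¹ := inv_anti₀ hxr0 (by linarith)
    have h2 : (1 - x - r)⁻¹ ≤ (1 - b - r)⁻¹ := inv_anti₀ (by linarith) (by linarith)
    rw [hτb]; linarith
  have hτb0 : 0 < τb := by
    have h1 : (2 : ℝ) < (b + r)⁻¹ := by rw [lt_inv_comm₀ two_pos (by linarith)]; linarith
    have h2 : (1 - b - r)⁻¹ < 2 := by rw [inv_lt_comm₀ (by linarith) two_pos]; linarith
    rw [hτb]; linarith
  have hτ : 0 < (x + r)⁻¹ - (1 - x - r)⁻¹ := by linarith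
  have main := abs_iteratedDeriv_smoothTransition_le_of_re hr hrx hx1 hτ n
  -- E ≤ e^{τb} ≤ e^{τx}
  have hEexp : E ≤ Real.exp τb := by
    have h1 : (2.7182818283 : ℝ) ^ k ≤ Real.exp k := by
      rw [show (k : ℝ) = k * 1 by ring, Real.exp_nat_mul]
      exact pow_le_pow_left₀ (by norm_num) Real.exp_one_gt_d9.le k
    have h2 : 1 + (τb - k) ≤ Real.exp (τb - k) := by linarith [Real.add_one_le_exp (τb - k)]
    have h3 : (0 : ℝ) ≤ 1 + (τb - k) := by linarith
    calc E = (2.7182818283 : ℝ) ^ k * (1 + (τb - k)) := rfl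
      _ ≤ Real.exp k * Real.exp (τb - k) := mul_le_mul h1 h2 h3 (Real.exp_pos _).le
      _ = Real.exp τb := by rw [← Real.exp_add]; ring_nf
  have hle : E - 1 ≤ Real.exp ((x + r)⁻¹ - (1 - x - r)⁻¹) - 1 := by
    linarith [Real.exp_le_exp.2 hτx]
  have hE0 : 0 < E - 1 := by rw [hE]; linarith
  calc |iteratedDeriv n Real.smoothTransition x| ≤ n ! * (Real.exp ((x + r)⁻¹ - (1 - x - r)⁻¹) - 1)⁻¹ / r ^ n := main
    _ ≤ n ! * (E - 1)⁻¹ / r ^ n := by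
        have := inv_anti₀ hE0 hle
        gcongr

/-- The worst case of the imaginary-part parameter on a piece: for `x ∈ [a,b]`, `r < a`, `b + r < 1`,
`r/(x²−r²) + r/((1−x)²−r²) ≤ r/(a²−r²) + r/((1−b)²−r²)`. -/
theorem stC_im_param_le_of_mem_Icc {a b r x : ℝ} (hr : 0 < r) (hra : r < a) (hb1 : b + r < 1) (hx : x ∈ Icc a b) :
    r / (x ^ 2 - r ^ 2) + r / ((1 - x) ^ 2 - r ^ 2) ≤ r / (a ^ 2 - r ^ 2) + r / ((1 - b) ^ 2 - r ^ 2) := by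
  have hxa := hx.1
  have hxb := hx.2
  have h1 : r / (x ^ 2 - r ^ 2) ≤ r / (a ^ 2 - r ^ 2) := by
    apply div_le_div_of_nonneg_left hr.le (by nlinarith) (by nlinarith)
  have h2 : r / ((1 - x) ^ 2 - r ^ 2) ≤ r / ((1 - b) ^ 2 - r ^ 2) := by
    apply div_le_div_of_nonneg_left hr.le (by nlinarith) (by nlinarith)
  linarith

/-- **Piece, imaginary-part route (`M = 1`)**: on `x ∈ [a,b]`, `r < a`, `b + r < 1`, `r/(a²−r²) + r/((1−b)²−r²) ≤ 3/2`:
`|σ^{(n)}(x)| ≤ n!/rⁿ` for every `n`. [cite: KrantzParks2002, Prop. 2.2.10] -/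
theorem abs_iteratedDeriv_smoothTransition_le_piece_im_one {a b r x : ℝ} (hr : 0 < r) (hra : r < a) (hb1 : b + r < 1)
    (hθ : r / (a ^ 2 - r ^ 2) + r / ((1 - b) ^ 2 - r ^ 2) ≤ 3 / 2) (hx : x ∈ Icc a b) (n : ℕ) :
    |iteratedDeriv n Real.smoothTransition x| ≤ n ! * 1 / r ^ n :=
  abs_iteratedDeriv_smoothTransition_le_of_im hr (by linarith [hx.1]) (by linarith [hx.2])
    ((stC_im_param_le_of_mem_Icc hr hra hb1 hx).trans hθ) n

/-- **Piece, imaginary-part route (`M = 2`)**: on `x ∈ [a,b]`, `r < a`, `b + r < 1`, `r/(a²−r²) + r/((1−b)²−r²) ≤ 5/2`: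
`|σ^{(n)}(x)| ≤ 2·n!/rⁿ` for every `n`. [cite: KrantzParks2002, Prop. 2.2.10] -/
theorem abs_iteratedDeriv_smoothTransition_le_piece_im_two {a b r x : ℝ} (hr : 0 < r) (hra : r < a) (hb1 : b + r < 1)
    (hθ : r / (a ^ 2 - r ^ 2) + r / ((1 - b) ^ 2 - r ^ 2) ≤ 5 / 2) (hx : x ∈ Icc a b) (n : ℕ) :
    |iteratedDeriv n Real.smoothTransition x| ≤ n ! * 2 / r ^ n :=
  abs_iteratedDeriv_smoothTransition_le_two_of_im hr (by linarith [hx.1]) (by linarith [hx.2])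
    ((stC_im_param_le_of_mem_Icc hr hra hb1 hx).trans hθ) n

/-! ## §4 Reflection, vanishing off `[0,1]`, continuity at the end points -/

/-- **Reflection**: `|σ^{(n)}(1 − x)| = |σ^{(n)}(x)|` for `n ≥ 1`. [folklore] -/
theorem abs_iteratedDeriv_smoothTransition_one_sub {n : ℕ} (hn : 1 ≤ n) (x : ℝ) :
    |iteratedDeriv n Real.smoothTransition (1 - x)| = |iteratedDeriv n Real.smoothTransition x| := by
  have h1 : iteratedDeriv n (fun z => Real.smoothTransition (1 - z)) x = (-1 : ℝ) ^ n • iteratedDeriv n Real.smoothTransition (1 - x) :=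
    congrFun (iteratedDeriv_comp_const_sub n Real.smoothTransition 1) x
  have h2 : iteratedDeriv n (fun z => Real.smoothTransition (1 - z)) x = -iteratedDeriv n Real.smoothTransition x := by
    -- `σ(1 − z) = 1 − σ(z)` (the tree's `Literature.NumberTheory.LFunctions.SelfDualAFE.smoothTransition_one_sub`, re-derived inline to keep
    -- the import graph of this calculus file free of the L-function library)
    have e : (fun z => Real.smoothTransition (1 - z)) = fun z => 1 - Real.smoothTransition z := by
      funext z
      have hd := Real.smoothTransition.pos_denom z
      rw [Real.smoothTransition, Real.smoothTransition, sub_sub_cancel, add_comm (expNegInvGlue (1 - z))]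
      field_simp
      ring
    rw [e, iteratedDeriv_const_sub (by omega) (1 : ℝ)]
    exact iteratedDeriv_neg n Real.smoothTransition x
  rw [h1, smul_eq_mul] at h2
  have h3 : |(-1 : ℝ) ^ n * iteratedDeriv n Real.smoothTransition (1 - x)| = |iteratedDeriv n Real.smoothTransition (1 - x)| := by
    rw [abs_mul, abs_pow, abs_neg, abs_one, one_pow, one_mul]
  rw [← h3, h2, abs_neg]

/-- The derivatives of positive order vanish on `(−∞, 0)`. [folklore] -/
theorem iteratedDeriv_smoothTransition_eq_zero_of_lt_zero {n : ℕ} (hn : 1 ≤ n) {x : ℝ} (hx : x < 0) :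
    iteratedDeriv n Real.smoothTransition x = 0 := by
  have hev : Real.smoothTransition =ᶠ[𝓝 x] fun _ => (0 : ℝ) := by
    filter_upwards [Iio_mem_nhds hx] with y hy using Real.smoothTransition.zero_of_nonpos (le_of_lt hy)
  rw [hev.iteratedDeriv_eq, iteratedDeriv_const]
  simp [show n ≠ 0 by omega]

/-- The derivatives of positive order vanish on `(1, ∞)`. [folklore] -/
theorem iteratedDeriv_smoothTransition_eq_zero_of_one_lt {n : ℕ} (hn : 1 ≤ n) {x : ℝ} (hx : 1 < x) :
    iteratedDeriv n Real.smoothTransition x = 0 := by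
  have hev : Real.smoothTransition =ᶠ[𝓝 x] fun _ => (1 : ℝ) := by
    filter_upwards [Ioi_mem_nhds hx] with y hy using Real.smoothTransition.one_of_one_le (le_of_lt hy)
  rw [hev.iteratedDeriv_eq, iteratedDeriv_const]
  simp [show n ≠ 0 by omega]

/-- From `(0, ½]` to everywhere: a bound `T ≥ 0` valid on `(0, ½]` for an order `n ≥ 1` holds at every real `x`. [folklore] -/
theorem abs_iteratedDeriv_smoothTransition_le_of_Ioc {n : ℕ} (hn : 1 ≤ n) {T : ℝ} (hT : 0 ≤ T)
    (h : ∀ x ∈ Ioc (0 : ℝ) (1 / 2), |iteratedDeriv n Real.smoothTransition x| ≤ T) (x : ℝ) :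
    |iteratedDeriv n Real.smoothTransition x| ≤ T := by
  -- the closed set where the bound holds contains the dense set {0, 1}ᶜ
  have hcont : Continuous (iteratedDeriv n Real.smoothTransition) :=
    Real.smoothTransition.contDiff.continuous_iteratedDeriv' n
  have hclosed : IsClosed {y : ℝ | |iteratedDeriv n Real.smoothTransition y| ≤ T} :=
    isClosed_le (continuous_abs.comp hcont) continuous_const
  have hopen : ∀ y : ℝ, y ≠ 0 → y ≠ 1 → |iteratedDeriv n Real.smoothTransition y| ≤ T := by
    intro y hy0 hy1
    rcases lt_or_gt_of_ne hy0 with h0 | h0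
    · rw [iteratedDeriv_smoothTransition_eq_zero_of_lt_zero hn h0, abs_zero]; exact hT
    rcases lt_or_gt_of_ne hy1 with h1 | h1
    · rcases le_or_gt y (1 / 2) with h2 | h2
      · exact h y ⟨h0, h2⟩
      · have : 1 - y ∈ Ioc (0 : ℝ) (1 / 2) := ⟨by linarith, by linarith⟩
        rw [← abs_iteratedDeriv_smoothTransition_one_sub hn, show 1 - y = 1 - y from rfl]
        have e : 1 - (1 - y) = y := by ring
        have := h (1 - y) this
        rwa [show (1 : ℝ) - y = 1 - y from rfl] at this
    · rw [iteratedDeriv_smoothTransition_eq_zero_of_one_lt hn h1, abs_zero]; exact hT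
  -- density argument at 0 and 1 via sequences y = x ± 1/(k+2)
  have hdense : Dense {y : ℝ | y ≠ 0 ∧ y ≠ 1} := by
    have : {y : ℝ | y ≠ 0 ∧ y ≠ 1} = ({0, 1} : Set ℝ)ᶜ := by ext y; simp
    rw [this]
    exact Set.Countable.dense_compl ℝ (Set.toFinite _).countable
  have hsub : {y : ℝ | y ≠ 0 ∧ y ≠ 1} ⊆ {y : ℝ | |iteratedDeriv n Real.smoothTransition y| ≤ T} :=
    fun y hy => hopen y hy.1 hy.2
  have : x ∈ {y : ℝ | |iteratedDeriv n Real.smoothTransition y| ≤ T} := by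
    have hcl : closure {y : ℝ | y ≠ 0 ∧ y ≠ 1} ⊆ {y : ℝ | |iteratedDeriv n Real.smoothTransition y| ≤ T} :=
      hclosed.closure_subset_iff.2 hsub
    exact hcl (hdense.closure_eq ▸ mem_univ x)
  exact this

/-! ## §5 The closed-form table for all `n` -/

/-- **THE CAUCHY TABLE**: for every `n` and every real `x`,
`|smoothTransition^{(n)}(x)| ≤ n!·(5·(199n/99)ⁿ·e^{−n} + 2·(15/2)ⁿ)`. [cite: KrantzParks2002, Prop. 2.2.10] -/
theorem abs_iteratedDeriv_smoothTransition_le_cauchy (n : ℕ) (x : ℝ) :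
    |iteratedDeriv n Real.smoothTransition x| ≤
      n ! * (5 * ((199 / 99 : ℝ) * n) ^ n * Real.exp (-n) + 2 * (15 / 2 : ℝ) ^ n) := by
  rcases Nat.eq_zero_or_pos n with rfl | hn
  · simp only [iteratedDeriv_zero, Nat.factorial_zero, Nat.cast_one, one_mul, pow_zero, mul_one, CharP.cast_eq_zero,
      neg_zero, Real.exp_zero]
    have h := Real.smoothTransition.nonneg x
    have h' := Real.smoothTransition.le_one x
    rw [abs_of_nonneg h]; linarith
  have hn1 : 1 ≤ n := hn
  have hT0 : 0 ≤ (n ! : ℝ) * (5 * ((199 / 99 : ℝ) * n) ^ n * Real.exp (-n) + 2 * (15 / 2 : ℝ) ^ n) := by positivity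
  refine abs_iteratedDeriv_smoothTransition_le_of_Ioc hn1 hT0 (fun y hy => ?_) x
  obtain ⟨hy0, hy2⟩ := hy
  have hA : (0 : ℝ) ≤ n ! * (5 * ((199 / 99 : ℝ) * n) ^ n * Real.exp (-n)) := by positivity
  have hB : (0 : ℝ) ≤ n ! * (2 * (15 / 2 : ℝ) ^ n) := by positivity
  by_cases h1 : y ≤ 3 / 20
  · -- regime (I)
    have h := abs_iteratedDeriv_smoothTransition_le_scaling (ρ := 99 / 100) (x₁ := 3 / 20) (by norm_num) (by norm_num) hy0 h1
      (by norm_num) n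
    have hK := smoothTransition_scaling_const_le_five
    calc |iteratedDeriv n Real.smoothTransition y|
        ≤ n ! * ((1 + 99 / 100) / (99 / 100)) ^ n * (n : ℝ) ^ n * Real.exp (-n) *
            (Real.exp (1 - (1 + 99 / 100 : ℝ) * (3 / 20))⁻¹ /
              (1 - Real.exp ((1 - (1 + 99 / 100 : ℝ) * (3 / 20))⁻¹ - ((1 + 99 / 100 : ℝ) * (3 / 20))⁻¹))) := h
      _ ≤ n ! * ((1 + 99 / 100) / (99 / 100)) ^ n * (n : ℝ) ^ n * Real.exp (-n) * 5 := by gcongr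
      _ = n ! * (5 * ((199 / 99 : ℝ) * n) ^ n * Real.exp (-n)) := by rw [mul_pow]; norm_num; ring
      _ ≤ _ := by rw [mul_add]; linarith
  rw [not_le] at h1
  -- regimes (II)/(III): three pieces
  have hpieces : |iteratedDeriv n Real.smoothTransition y| ≤ n ! * 2 / (2 / 15) ^ n := by
    by_cases h2 : y ≤ 297 / 1000
    · -- piece II: [3/20, 297/1000], r = 7/50, k = 0
      have h := abs_iteratedDeriv_smoothTransition_le_piece_re (a := 3 / 20) (b := 297 / 1000) (r := 7 / 50) 0
        (by norm_num) (by norm_num) (by norm_num) (by norm_num) (by norm_num) ⟨h1.le, h2⟩ n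
      refine h.trans ?_
      have hM : (((2.7182818283 : ℝ) ^ (0 : ℕ) * (1 + (((297 / 1000 : ℝ) + 7 / 50)⁻¹ - (1 - 297 / 1000 - 7 / 50)⁻¹ - (0 : ℕ)))) - 1)⁻¹ ≤ 2 := by
        norm_num
      calc (n ! : ℝ) * (((2.7182818283 : ℝ) ^ (0 : ℕ) * (1 + (((297 / 1000 : ℝ) + 7 / 50)⁻¹ - (1 - 297 / 1000 - 7 / 50)⁻¹ - (0 : ℕ)))) - 1)⁻¹ / (7 / 50) ^ n
          ≤ n ! * 2 / (7 / 50) ^ n := by gcongr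
        _ ≤ n ! * 2 / (2 / 15) ^ n := by
            apply div_le_div_of_nonneg_left (by positivity) (by positivity)
            exact pow_le_pow_left₀ (by norm_num) (by norm_num) n
    rw [not_le] at h2
    by_cases h3 : y ≤ 484 / 1000
    · -- piece III (M = 2): [297/1000, 484/1000], r = 27/200
      have h := abs_iteratedDeriv_smoothTransition_le_piece_im_two (a := 297 / 1000) (b := 484 / 1000) (r := 27 / 200)
        (by norm_num) (by norm_num) (by norm_num) (by norm_num) ⟨h2.le, h3⟩ n
      refine h.trans ?_
      apply div_le_div_of_nonneg_left (by positivity) (by positivity)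
      exact pow_le_pow_left₀ (by norm_num) (by norm_num) n
    · -- piece III (M = 2): [484/1000, 1/2], r = 23/100
      rw [not_le] at h3
      have h := abs_iteratedDeriv_smoothTransition_le_piece_im_two (a := 484 / 1000) (b := 1 / 2) (r := 23 / 100)
        (by norm_num) (by norm_num) (by norm_num) (by norm_num) ⟨h3.le, hy2⟩ n
      refine h.trans ?_
      apply div_le_div_of_nonneg_left (by positivity) (by positivity)
      exact pow_le_pow_left₀ (by norm_num) (by norm_num) n
  calc |iteratedDeriv n Real.smoothTransition y| ≤ n ! * 2 / (2 / 15) ^ n := hpieces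
    _ = n ! * (2 * (15 / 2 : ℝ) ^ n) := by
        rw [show (2 / 15 : ℝ) = (15 / 2)⁻¹ by norm_num, inv_pow]; field_simp
    _ ≤ _ := by rw [mul_add]; linarith

/-! ## §6 A rational envelope of `e^{−n}` for numeral rows -/

/-- `e^{−n} ≤ (1/2.7182818283)ⁿ`. -/
theorem stC_exp_neg_nat_le (n : ℕ) : Real.exp (-n) ≤ (10000000000 / 27182818283 : ℝ) ^ n := by
  rw [show (-(n : ℝ)) = n * (-1) by ring, Real.exp_nat_mul]
  apply pow_le_pow_left₀ (Real.exp_pos _).le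
  rw [Real.exp_neg]
  calc (Real.exp 1)⁻¹ ≤ (2.7182818283 : ℝ)⁻¹ := inv_anti₀ (by norm_num) Real.exp_one_gt_d9.le
    _ = 10000000000 / 27182818283 := by norm_num

end Summit.HubbardSuperconductivity.HubbardSuperconductivity.Theorems.KLRegimeSplit

end
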